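import Summits.Ventures.HSemireg.WedgeHankelRecurrenceGaussChebyshevTUResultantClosed

/-!
# Venture HSemireg — **THE MONIC (VIETA–FIBONACCI) NORMALISATION: THE IDEAL `(S_{m−1}, S_{n−1}) = (S_{gcd(m,n)−1})` IN `R[X]` FOR EVERY COMMUTATIVE RING, AND `IsCoprime S_{m−1} S_{n−1} ⟺
# gcd(m,n) = 1` OVER EVERY NONTRIVIAL COMMUTATIVE RING** (Mathlib's rescaled second-kind Chebyshev polynomials `S_n(x) = U_n(x∕2)`, monic with integer coefficients — the characteristic
# polynomials of the path graphs ∕ of the free Jacobi matrix with zero diagonal and unit couplings): the addition formula `S_{m+n} = S_m S_n − S_{m−1} S_{n−1}`, Cassini coprimality from Mathlib's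
# `S_n² + S_{n+1}² − X S_n S_{n+1} = 1`, the Euclidean step, the `Nat.gcd` induction of N457, and monicity (`deg S_n = n`, so `S_{g−1}` is a unit iff `g = 1` with no hypothesis on `2`)

HONEST FRAMING. Part of the Lean index of the computation cell `pub-hsemireg` (seat p10 gen 48, Sunday typer «UNIFORM-IN-n»).  Polynomial ∕ ideal algebra only; no variety, no cohomology theory,
no sheaf, no Ext group and no semiregularity map is constructed here; nothing here says that HC / HC_CM / HC_AV holds; no Literature fact (unproved `Prop`) is declared or used.  Custodian versions
as in `WedgeHankelSiegelIdeal` (1/3).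
SOURCES (cited).  V. E. Hoggatt Jr., C. T. Long, *Divisibility properties of generalized Fibonacci polynomials*, Fibonacci Quart. 12 (1974) 113–120 (strong divisibility `gcd(u_m, u_n) = u_{gcd(m,n)}`);
M. O. Rayes, V. Trevisan, P. S. Wang, Comput. Math. Appl. 50 (2005) 1231–1240, Thm 5 (the `U`-form); Mathlib `Polynomial.Chebyshev.S` (`S_comp_two_mul_X : S_n(2X) = U_n`).
PROOF TYPED HERE.  Mathlib `S_add_two ∕ S_add_one ∕ S_sub_one`, `S_zero ∕ S_one ∕ S_neg_one`, `S_sq_add_S_sq`, `Polynomial.Chebyshev.induct`, `Ideal.span_pair_add_mul_right`, `Ideal.span_pair_comm ∕ _zero`,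
`Ideal.mem_span_pair ∕ _singleton`, `Nat.gcd.induction`, `Polynomial.Monic.isUnit_iff`; N404 `recurrence_natDegree_leadingCoeff` (degree ∕ monicity of `S_n` from the recurrence); N457
`span_pair_mul_right_of_isCoprime`.
DEDUP DISCLOSURE (`rg -n 'chebyshevS_' Summits Literature HarnessLib`; `rg -n 'Chebyshev.S ' Literature` — `MatchingsChebyshev`, `ChebyshevPowerSums`, `HeckeLambdaDivisorBoundWeightTwo`, `MS87HeatKernelGroup`
use `S` for other purposes (matching polynomials, power sums, Hecke bounds), no gcd ∕ ideal statement, 2026-09-04): 0 hits for the 12 names below.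

WHAT IS IN THE TREE.  N404, N457 (the `U`-version), Mathlib `S`.
THIS FILE (namespace `Summit.Ventures.HSemireg.Wedge.HankelOuter` continued; CHAINED on N464; 0 definitions):
* §1230 **`chebyshevS_add`** (`S_{m+n} = S_m S_n − S_{m−1} S_{n−1}`), **`chebyshev_isCoprime_S_succ`**, `chebyshevS_natDegree_monic` (`deg S_n = n`, monic; nontrivial ring), `chebyshevS_span_pair_add`,
  `chebyshevS_span_pair_add_mul`, **`chebyshevS_span_pair_eq_span_gcd`** (`(S_{m−1}, S_{n−1}) = (S_{gcd(m,n)−1})`), `chebyshevS_bezout_gcd`, `dvd_chebyshevS_gcd`, `chebyshevS_gcd_pred_dvd_left ∕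
  _right`, **`chebyshevS_isCoprime_pred_of_coprime`**, **`chebyshevS_isCoprime_pred_iff_coprime`** (nontrivial rings, no hypothesis on `2`).
CAVEATS.  Nothing Ext-side.  New names only.
-/

open Module Polynomial
open scoped Matrix Polynomial

namespace Summit.Ventures.HSemireg.Wedge.HankelOuter

/-! ## §1230. The ideal `(S_{m−1}, S_{n−1}) = (S_{gcd(m,n)−1})` -/

/-- **ADDITION FORMULA `S_{m+n} = S_m S_n − S_{m−1} S_{n−1}`** (all `m, n ∈ ℤ`, any commutative ring). [Hoggatt–Long 1974 (2.x); this file, §1230] -/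
theorem chebyshevS_add {R : Type*} [CommRing R] (m n : ℤ) :
    Polynomial.Chebyshev.S R (m + n) = Polynomial.Chebyshev.S R m * Polynomial.Chebyshev.S R n - Polynomial.Chebyshev.S R (m - 1) * Polynomial.Chebyshev.S R (n - 1) := by
  induction n using Polynomial.Chebyshev.induct with
  | zero => simp only [add_zero, zero_sub, Polynomial.Chebyshev.S_zero, Polynomial.Chebyshev.S_neg_one, mul_one, mul_zero, sub_zero]
  | one => rw [show (1 : ℤ) - 1 = 0 by norm_num, Polynomial.Chebyshev.S_zero, Polynomial.Chebyshev.S_one, Polynomial.Chebyshev.S_add_one]; ring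
  | add_two n ih1 ih2 =>
    have h₁ := Polynomial.Chebyshev.S_add_two R (m + n)
    have h₃ := Polynomial.Chebyshev.S_add_two R (n : ℤ)
    have h₄ := Polynomial.Chebyshev.S_add_one R (n : ℤ)
    linear_combination (norm := ring_nf) h₁ + (X : R[X]) * ih1 - ih2 - Polynomial.Chebyshev.S R m * h₃ + Polynomial.Chebyshev.S R (m - 1) * h₄
  | neg_add_one n ih1 ih2 =>
    have h₁ := Polynomial.Chebyshev.S_sub_one R (m - n)
    have h₃ := Polynomial.Chebyshev.S_sub_one R (-(n : ℤ))
    have h₄ := Polynomial.Chebyshev.S_sub_one R (-(n : ℤ) - 1)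
    linear_combination (norm := ring_nf) h₁ + (X : R[X]) * ih1 - ih2 - Polynomial.Chebyshev.S R m * h₃ + Polynomial.Chebyshev.S R (m - 1) * h₄

/-- **Cassini coprimality: `S_{n+1}`, `S_n` are coprime** (any commutative ring; from `S_n² + S_{n+1}² − X S_n S_{n+1} = 1`). [Mathlib `S_sq_add_S_sq`; this file, §1230] -/
theorem chebyshev_isCoprime_S_succ {R : Type*} [CommRing R] (n : ℤ) : IsCoprime (Polynomial.Chebyshev.S R (n + 1)) (Polynomial.Chebyshev.S R n) :=
  ⟨Polynomial.Chebyshev.S R (n + 1) - Polynomial.X * Polynomial.Chebyshev.S R n, Polynomial.Chebyshev.S R n, by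
    linear_combination Polynomial.Chebyshev.S_sq_add_S_sq R n⟩

/-- `deg S_n = n` and `S_n` is monic (`n ∈ ℕ`, nontrivial commutative ring). [N404 `recurrence_natDegree_leadingCoeff` with `a = 0`, `b = 1`; this file, §1230] -/
theorem chebyshevS_natDegree_monic {R : Type*} [CommRing R] [Nontrivial R] (n : ℕ) :
    (Polynomial.Chebyshev.S R (n : ℤ)).natDegree = n ∧ (Polynomial.Chebyshev.S R (n : ℤ)).Monic := by
  have h := recurrence_natDegree_leadingCoeff (q := fun k : ℕ => Polynomial.Chebyshev.S R (k : ℤ)) (a := fun _ => (0 : R)) (b := fun _ => (1 : R))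
    (by simp only [Nat.cast_zero, Polynomial.Chebyshev.S_zero]) (by simp only [Nat.cast_one, Polynomial.Chebyshev.S_one, map_zero, sub_zero])
    (fun k => by
      simp only [Nat.cast_add, Nat.cast_ofNat, Nat.cast_one, map_zero, sub_zero, map_one, one_mul]
      exact Polynomial.Chebyshev.S_add_two R (k : ℤ)) n
  exact ⟨h.1, h.2⟩

/-- **Euclidean step for ideals: `(S_{j+m}, S_{m−1}) = (S_j, S_{m−1})`** (any commutative ring). [this file, §1230] -/
theorem chebyshevS_span_pair_add {R : Type*} [CommRing R] (j m : ℤ) :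
    Ideal.span {Polynomial.Chebyshev.S R (j + m), Polynomial.Chebyshev.S R (m - 1)} =
      Ideal.span {Polynomial.Chebyshev.S R j, Polynomial.Chebyshev.S R (m - 1)} := by
  have hadd : Polynomial.Chebyshev.S R (j + m) =
      Polynomial.Chebyshev.S R j * Polynomial.Chebyshev.S R m + (-Polynomial.Chebyshev.S R (j - 1)) * Polynomial.Chebyshev.S R (m - 1) := by
    rw [chebyshevS_add]; ring
  have hsucc : IsCoprime (Polynomial.Chebyshev.S R m) (Polynomial.Chebyshev.S R (m - 1)) := by
    have h := chebyshev_isCoprime_S_succ (R := R) (m - 1)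
    rwa [sub_add_cancel] at h
  rw [hadd, Ideal.span_pair_add_mul_right, span_pair_mul_right_of_isCoprime hsucc]

/-- Iterated: `(S_{j+km}, S_{m−1}) = (S_j, S_{m−1})` (`k ∈ ℕ`). [this file, §1230] -/
theorem chebyshevS_span_pair_add_mul {R : Type*} [CommRing R] (j m : ℤ) (k : ℕ) :
    Ideal.span {Polynomial.Chebyshev.S R (j + k * m), Polynomial.Chebyshev.S R (m - 1)} =
      Ideal.span {Polynomial.Chebyshev.S R j, Polynomial.Chebyshev.S R (m - 1)} := by
  induction k with
  | zero => rw [Nat.cast_zero, zero_mul, add_zero]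
  | succ k ih => rw [Nat.cast_succ, add_one_mul, ← add_assoc, chebyshevS_span_pair_add, ih]

/-- **`(S_{m−1}, S_{n−1}) = (S_{gcd(m,n)−1})` as ideals of `R[X]`, for all `m, n ∈ ℕ` and every commutative ring `R`** (`S_{−1} = 0`). [Hoggatt–Long 1974, ideal form; this file, §1230] -/
theorem chebyshevS_span_pair_eq_span_gcd {R : Type*} [CommRing R] (m n : ℕ) :
    Ideal.span {Polynomial.Chebyshev.S R ((m : ℤ) - 1), Polynomial.Chebyshev.S R ((n : ℤ) - 1)} =
      Ideal.span {Polynomial.Chebyshev.S R ((Nat.gcd m n : ℤ) - 1)} := by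
  induction m, n using Nat.gcd.induction with
  | H0 n =>
    rw [Nat.cast_zero, zero_sub, Polynomial.Chebyshev.S_neg_one, Ideal.span_pair_comm, Ideal.span_pair_zero, Nat.gcd_zero_left]
  | H1 m n _hm ih =>
    rw [Nat.gcd_rec, ← ih, Ideal.span_pair_comm]
    conv_lhs => rw [← Nat.mod_add_div n m]
    rw [show ((((n % m + m * (n / m) : ℕ)) : ℤ)) - 1 = (((n % m : ℕ) : ℤ) - 1) + ((n / m : ℕ) : ℤ) * (m : ℤ) by push_cast; ring,
      chebyshevS_span_pair_add_mul]

/-- **Bézout: `a·S_{m−1} + b·S_{n−1} = S_{gcd(m,n)−1}` for some `a, b ∈ R[X]`.** [this file, §1230] -/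
theorem chebyshevS_bezout_gcd {R : Type*} [CommRing R] (m n : ℕ) :
    ∃ a b : R[X], a * Polynomial.Chebyshev.S R ((m : ℤ) - 1) + b * Polynomial.Chebyshev.S R ((n : ℤ) - 1) = Polynomial.Chebyshev.S R ((Nat.gcd m n : ℤ) - 1) :=
  Ideal.mem_span_pair.1 (by rw [chebyshevS_span_pair_eq_span_gcd]; exact Ideal.mem_span_singleton_self _)

/-- **gcd universal property: a common divisor of `S_{m−1}` and `S_{n−1}` divides `S_{gcd(m,n)−1}`** (any commutative ring). [this file, §1230] -/
theorem dvd_chebyshevS_gcd {R : Type*} [CommRing R] {m n : ℕ} {p : R[X]}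
    (hm : p ∣ Polynomial.Chebyshev.S R ((m : ℤ) - 1)) (hn : p ∣ Polynomial.Chebyshev.S R ((n : ℤ) - 1)) :
    p ∣ Polynomial.Chebyshev.S R ((Nat.gcd m n : ℤ) - 1) := by
  obtain ⟨a, b, h⟩ := chebyshevS_bezout_gcd (R := R) m n
  rw [← h]
  exact dvd_add (dvd_mul_of_dvd_right hm a) (dvd_mul_of_dvd_right hn b)

/-- `S_{gcd(m,n)−1} ∣ S_{m−1}`. [this file, §1230] -/
theorem chebyshevS_gcd_pred_dvd_left {R : Type*} [CommRing R] (m n : ℕ) :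
    Polynomial.Chebyshev.S R ((Nat.gcd m n : ℤ) - 1) ∣ Polynomial.Chebyshev.S R ((m : ℤ) - 1) := by
  rw [← Ideal.mem_span_singleton, ← chebyshevS_span_pair_eq_span_gcd]
  exact Ideal.subset_span (Set.mem_insert _ _)

/-- `S_{gcd(m,n)−1} ∣ S_{n−1}`. [this file, §1230] -/
theorem chebyshevS_gcd_pred_dvd_right {R : Type*} [CommRing R] (m n : ℕ) :
    Polynomial.Chebyshev.S R ((Nat.gcd m n : ℤ) - 1) ∣ Polynomial.Chebyshev.S R ((n : ℤ) - 1) := by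
  rw [← Ideal.mem_span_singleton, ← chebyshevS_span_pair_eq_span_gcd]
  exact Ideal.subset_span (Set.mem_insert_of_mem _ (Set.mem_singleton _))

/-- **`gcd(m,n) = 1 ⇒ S_{m−1}, S_{n−1}` coprime in `R[X]` for EVERY commutative ring `R`.** [this file, §1230] -/
theorem chebyshevS_isCoprime_pred_of_coprime {R : Type*} [CommRing R] {m n : ℕ} (h : Nat.Coprime m n) :
    IsCoprime (Polynomial.Chebyshev.S R ((m : ℤ) - 1)) (Polynomial.Chebyshev.S R ((n : ℤ) - 1)) := by
  obtain ⟨a, b, hab⟩ := chebyshevS_bezout_gcd (R := R) m n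
  rw [Nat.Coprime.gcd_eq_one h, Nat.cast_one, sub_self, Polynomial.Chebyshev.S_zero] at hab
  exact ⟨a, b, hab⟩

/-- **`IsCoprime S_{m−1} S_{n−1} ⟺ gcd(m,n) = 1` over EVERY NONTRIVIAL commutative ring** (monicity: `S_{g−1}` is a unit iff `g = 1`; no hypothesis on `2`, in contrast with the `U`-form N457).
[Hoggatt–Long 1974; this file, §1230] -/
theorem chebyshevS_isCoprime_pred_iff_coprime {R : Type*} [CommRing R] [Nontrivial R] (m n : ℕ) :
    IsCoprime (Polynomial.Chebyshev.S R ((m : ℤ) - 1)) (Polynomial.Chebyshev.S R ((n : ℤ) - 1)) ↔ Nat.Coprime m n := by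
  refine ⟨fun h => ?_, chebyshevS_isCoprime_pred_of_coprime⟩
  have hunit : IsUnit (Polynomial.Chebyshev.S R ((Nat.gcd m n : ℤ) - 1)) :=
    h.isUnit_of_dvd' (chebyshevS_gcd_pred_dvd_left m n) (chebyshevS_gcd_pred_dvd_right m n)
  obtain ⟨g, hg⟩ : ∃ g, Nat.gcd m n = g := ⟨_, rfl⟩
  rw [hg] at hunit
  rcases g with _ | k
  · rw [Nat.cast_zero, zero_sub, Polynomial.Chebyshev.S_neg_one] at hunit
    exact absurd hunit not_isUnit_zero
  · obtain ⟨hdeg, hmonic⟩ := chebyshevS_natDegree_monic (R := R) k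
    rw [show (((k + 1 : ℕ)) : ℤ) - 1 = (k : ℤ) by push_cast; ring, hmonic.isUnit_iff] at hunit
    rw [hunit, natDegree_one] at hdeg
    show Nat.gcd m n = 1
    rw [hg, ← hdeg]

end Summit.Ventures.HSemireg.Wedge.HankelOuter
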